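import Literature.Probability.LatticeModels.KilledWalkHubFactorisation
import Literature.Probability.LatticeModels.KilledWalkGreen
import HarnessLib

/-!
# Green-function upper bound by hitting probabilities (line `symplectic-fermion-anchor`,
crux `SAWLoopFugacityFlow.AvoidanceLimit`, stmt-CriticalPhenomena-10649)

The hub-term bound of Chelkak's factorisation `P_Λ(m,x) ≍ hitProb_{B*}(m) · P_Λ(u*,x)` of the exit
kernel of the edge-killed walk (walk on `ℤ²` along the edges of `Gr`, killed at its first non-`Gr`
step and on leaving the finite region `Λ`) through a hub box `B*` (Chelkak 2016, Proposition 3.1):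
`hitProb_{B}(m) ≥ G_Λ(m,c) / max_{B} G_Λ(·,c)` for a pole `c ∈ B`, where `G_Λ = killedRegionGreen Gr Λ`
is the Green function of the killed walk. This is the companion (reverse direction) of
`hitProb_mul_le_killedRegionGreen` of the wall-ball bounds file.

* `killedRegionGreen_le_mul_hitProb` — if `G_Λ(w,c) ≤ M` for every `w ∈ B` (`0 ≤ M`, `c ∈ B`), then
  `G_Λ(m,c) ≤ M · hitProb_B(m)` for every `m`: `G_Λ(·,c)` is killed-harmonic on `Λ ∖ B ⊆ Λ ∖ {c}`
  and vanishes off `Λ`, `M · hitProb_B` is killed-harmonic on `Λ ∖ B`, equal to `M` on `B` and to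
  `0` off `Λ`; comparison principle on `Λ ∖ B`.

Everything is proved from the maximum principle of `KilledWalkLaplacian.lean`. No definitions.
Source: D. Chelkak, *Robust discrete complex analysis: a toolbox*, Ann. Probab. 44 (2016), §3.1
[Chelkak2016].
-/

noncomputable section

open scoped BigOperators Classical
open Finset
open Literature.Probability.LatticeModels

namespace Summit.CriticalPhenomena.SAWScalingLimit.Theorems.AvoidanceLimit.Anchor

/-- **Green-function upper bound by hitting probabilities.** For the edge-killed walk `Gr` in the
finite region `Λ`, a set `B ⊆ Λ`, a pole `c ∈ B` and `0 ≤ M`: if `G_Λ(w,c) ≤ M` for all `w ∈ B`,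
then `G_Λ(m,c) ≤ M · hitProb Gr Λ B m` for every `m` — on `Λ ∖ B` by the comparison principle
(`G_Λ(·,c)` is killed-harmonic on `Λ ∖ B ⊆ Λ ∖ {c}`, `M · hitProb_B` is killed-harmonic on `Λ ∖ B`,
and the inequality holds off `Λ ∖ B`: on `B` it is the hypothesis since `hitProb_B = 1` there, and
off `Λ` the left side vanishes while `hitProb_B ≥ 0`). This is the hub-term bound
`hitProb_{B*}(u) ≥ G(u,c*) / max_{B*} G(·,c*)`. [cite: Chelkak2016, Proposition 3.1] -/
theorem killedRegionGreen_le_mul_hitProb :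
    ∀ (Gr : SimpleGraph (Site 2)) (Λ B : Set (Site 2)), Λ.Finite → B ⊆ Λ → ∀ (c : Site 2), c ∈ B →
      ∀ (M : ℝ), 0 ≤ M → (∀ w ∈ B, killedRegionGreen Gr Λ w c ≤ M) →
      ∀ m : Site 2, killedRegionGreen Gr Λ m c ≤ M * hitProb Gr Λ B m := by
  intro Gr Λ B hΛ _ c hc M hM0 hM m
  have hSfin : (Λ \ B).Finite := hΛ.subset fun _ hz => hz.1
  -- off `Λ ∖ B`: on `B` the hypothesis (`hitProb = 1`), off `Λ` the left side is `0`
  have hoff : ∀ z, z ∉ Λ \ B → killedRegionGreen Gr Λ z c ≤ M * hitProb Gr Λ B z := by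
    intro z hz
    by_cases hzB : z ∈ B
    · rw [hitProb_of_mem hzB, mul_one]; exact hM z hzB
    · have hzΛ : z ∉ Λ := fun h => hz ⟨h, hzB⟩
      rw [killedRegionGreen_of_not_mem_left Λ hzΛ c]
      exact mul_nonneg hM0 (hitProb_nonneg hΛ z)
  by_cases hm : m ∈ Λ \ B
  · -- `G_Λ(·,c)` is killed-harmonic on `Λ ∖ {c} ⊇ Λ ∖ B` (as `c ∈ B`)
    have h1 : IsKilledHarmonicOn Gr (fun z => killedRegionGreen Gr Λ z c) (Λ \ B) :=
      (killedRegionGreen_harmonicOn hΛ c).mono fun z hz =>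
        ⟨hz.1, fun h => hz.2 (by rw [Set.mem_singleton_iff.1 h]; exact hc)⟩
    -- `M · hitProb_B` is killed-harmonic on `Λ ∖ B`
    have h2 : IsKilledHarmonicOn Gr (fun z => M * hitProb Gr Λ B z) (Λ \ B) :=
      (hitProb_harmonicOn hΛ).const_mul M
    exact le_of_killedSub_killedSuper_of_boundary hSfin h1.subharmonicOn h2.superharmonicOn
      (fun z hz => hoff z hz.1) m hm
  · exact hoff m hm

end Summit.CriticalPhenomena.SAWScalingLimit.Theorems.AvoidanceLimit.Anchor

end
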